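import Literature.Computability.QuantumComplexity.SketchedOversamplingAccess
import Literature.Computability.QuantumComplexity.SketchedEigenvalueTransformation
import Literature.Analysis.Matrix.PushThroughIdentity
import Mathlib.Analysis.Matrix.Normed
import HarnessLib

/-!
# Even singular value transformation from `SQ_φ(A)` (CGLLTW 2022, §5.3 Theorem "evenSing"),
# Frobenius form: the error decomposition and the two-sketch statement, end to end

Chia, Gilyén, Li, Lin, Tang, Wang, *Sampling-based sublinear low-rank matrix arithmetic framework
for dequantizing quantum machine learning*, J. ACM 69(5):33 (2022) = arXiv:1910.06151.  The main
theorem (§3.1, held arXiv text p. 17 L7–24):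

> **Theorem (Even singular value transformation).** Let `A ∈ ℂ^{m×n}` and `f : ℝ⁺ → ℂ` be such
> that `f` and `\bar f(x) := (f(x) − f(0))/x` are `L`-Lipschitz and `\bar L`-Lipschitz,
> respectively, on `∪_{i=1}^n [σ_i² − d, σ_i² + d]` for some `d > 0`. Take parameters `ε` and `δ`
> such that `0 < ε ≲ L‖A‖_*²` and `δ ∈ (0,1]`. Choose a norm `* ∈ {F, Op}`. Suppose we have
> `SQ_φ(A)`. Consider the importance sampling sketch `S ∈ ℝ^{r×m}` corresponding to `SQ_φ(A)` and
> the importance sampling sketch `T† ∈ ℝ^{c×n}` corresponding to `SQ_{≤2φ}((SA)†)` (which we have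
> by (lem:sq-sketching)). Then, for `R := SA` and `C := SAT`, we can achieve the bound
> `Pr[‖R† \bar f(CC†) R + f(0)I − f(A†A)‖_* > ε] < δ`, if `r, c > ‖A‖²‖A‖_F² φ² (1/d²) log(1/δ)`
> […] and `r = Ω̃(φ² L² ‖A‖_*² ‖A‖_F² ε⁻² log(1/δ))`, `c = Ω̃(φ² \bar L² ‖A‖⁴ ‖A‖_*² ‖A‖_F² ε⁻² log(1/δ))`.
> […] Finally, we note that no additional log terms are necessary (i.e., `Ω̃` becomes `Ω`) when
> Frobenius norm is used.

and its proof, **§5.3 "Singular value transformation"** (p. 37 L87–135), with `R = SA`, `C = RT`: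

> Since `f(A†A) = [f(x) − f(0)](A†A) + f(0)I`, it suffices to show for those `f` such that
> `f(0) = 0`. […]
> • `‖f(R†R) − f(A†A)‖_* ≤ ε/2`. […] (lemma:lipschitz) or (lem:lipschitz-frob) […]
>   (lem:AMP-spectral) or (prop:appr-mms) […]
> • `‖f(CC†) − f(RR†)‖_* ≤ (ε/2)‖R‖²`. This follows similarly to the above point […]
> Using the above points, we can conclude:
>   `‖R† \bar f(CC†) R − f(A†A)‖_*`
>   `≤ ‖R† \bar f(RR†) R − f(A†A)‖_* + ‖R†(\bar f(RR†) − \bar f(CC†))R‖_*`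
>   `= ‖f(R†R) − f(A†A)‖_* + ‖R†(\bar f(RR†) − \bar f(CC†))R‖_*`   (definition of `\bar f`)
>   `≤ ‖f(R†R) − f(A†A)‖_* + ‖R‖²‖\bar f(RR†) − \bar f(CC†)‖_*`
>   `≲ ε`.
> This immediately gives (eq:evenSVTbound).

This file formalises that chain for REAL matrices in the case the proof reduces to — `f(0) = 0`
(so `\bar f(x) = f(x)/x`, encoded as the hypothesis `x·\bar f(x) = f(x)` for `x ≥ 0`), `d = ∞`
(Lipschitz hypotheses on all of `[0,∞)`, the paper's "smooth everywhere" remark after the theorem),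
Frobenius norm `* = F` — with the operator-norm factor `‖R‖²` of the last display relaxed to
`‖R‖_F² ≤ φ‖A‖_F²` (`‖R‖ ≤ ‖R‖_F`; the tree's SQ toolbox is Frobenius throughout, so the printed
`‖A‖⁴` of the `c`-bound appears here as `φ²‖A‖_F⁴`), and explicit constants in place of `Ω̃`.  It
then assembles the two-sketch statement from pieces already in the tree:

* `sqrt_frobSq_mul_le`, `sqrt_frobSq_transpose_mul_mul_le` (`‖RᵀYR‖_F ≤ ‖R‖_F²‖Y‖_F`; private
  plumbing: the bridge `√frobSq = ‖·‖_F` to Mathlib's Frobenius norm, triangle inequality, `‖Xᵀ‖_F`);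
* `transpose_mul_cfc_mul_self_eq` — the step "= (definition of `\bar f`)":
  `Rᵀ \bar f(RRᵀ) R = f(RᵀR)` whenever `x \bar f(x) = f(x)` on `[0,∞)` (Higham's push-through
  identity `Literature.Analysis.Matrix.PushThrough.conjTranspose_mul_cfc_mul_self` and
  `spec(RᵀR) ⊆ [0,∞)`);
* `evenSVT_error_le` — **the displayed decomposition** (deterministic, any `R`, `C`, `A`):
  `‖Rᵀ \bar f(CCᵀ) R − f(AᵀA)‖_F ≤ ‖f(RᵀR) − f(AᵀA)‖_F + ‖R‖_F² ‖\bar f(RRᵀ) − \bar f(CCᵀ)‖_F`;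
* `even_singular_value_transformation` — **the theorem, Frobenius form, explicit constants**:
  for `SQ_φ(A)` (`A ≠ 0`), `f` with `|f x − f y| ≤ L|x − y|` and `\bar f` with
  `|\bar f x − \bar f y| ≤ \bar L|x − y|` on `[0,∞)`, `x \bar f(x) = f(x)` there, `s, c ≥ 1`,
  `s ≥ 2φ² ln(1/δ₃)`: sampling `ω ∈ [m]^s` i.i.d. from `𝒟_ã` (`R = S_ωA`) and then `τ ∈ [n]^c`
  i.i.d. from the row-norm distribution of `(S_ωÃ)ᵀ` (`C = R T_τᵀ`), the two-stage mass of
  `‖Rᵀ \bar f(CCᵀ) R − f(AᵀA)‖_F < (L√(8φ² log(2/δ₁)/s) + \bar L φ² √(32φ² log(2/δ₂)/c) ‖A‖_F²)·‖A‖_F²`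
  exceeds `1 − δ₁ − δ₂ − δ₃` — the key lemma for `S` and Lemma 5.4 (first bullet, as in
  `sketch_eigenvalueTransform_stable`), Lemma 2.14 (`φ_ω ≤ 2φ` off an event of mass `≤ δ₃`) with
  the key lemma for `T†` and Lemma 5.4 (fourth bullet), `‖R‖_F² ≤ φ‖A‖_F²`, and
  `evenSVT_error_le`.  (The paper's `r, c = Ω̃(…)` choices making this `≤ ε` are read off by
  solving for `s, c`; its spectral-norm variant needs Lemmas 5.5/5.6 and (lem:AMP-spectral), not
  in the tree.)

All statements are theorems; no named facts; standard axioms.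
-/

noncomputable section

open scoped Matrix

namespace Literature.Computability.QuantumComplexity

namespace SampleQuery

open Finset Literature.Analysis.Matrix

variable {m n s c : ℕ} {φ : ℝ} {A : Matrix (Fin m) (Fin n) ℝ}

/-! ### Frobenius-norm plumbing for the toolbox's `frobSq` -/

section frobenius

open scoped Matrix.Norms.Frobenius

/-- Bridge: `√(frobSq M)` is Mathlib's (scoped) Frobenius norm `‖M‖`. [folklore] -/
private theorem sqrt_frobSq_eq_norm {k l : ℕ} (M : Matrix (Fin k) (Fin l) ℝ) :
    Real.sqrt (frobSq M) = ‖M‖ := by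
  rw [Matrix.frobenius_norm_def, Real.sqrt_eq_rpow, frobSq_eq_sum_sq]
  congr 1
  refine Finset.sum_congr rfl fun i _ => Finset.sum_congr rfl fun j _ => ?_
  rw [Real.rpow_two, Real.norm_eq_abs, sq_abs]

/-- Triangle inequality `‖X + Y‖_F ≤ ‖X‖_F + ‖Y‖_F`. [folklore] -/
private theorem sqrt_frobSq_add_le {k l : ℕ} (X Y : Matrix (Fin k) (Fin l) ℝ) :
    Real.sqrt (frobSq (X + Y)) ≤ Real.sqrt (frobSq X) + Real.sqrt (frobSq Y) := by
  simp only [sqrt_frobSq_eq_norm]; exact norm_add_le X Y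

/-- Submultiplicativity `‖XY‖_F ≤ ‖X‖_F‖Y‖_F`. [cite: HornJohnson2013, §5.6 Example after
(5.6.0.2) (PDF p. 433: the Frobenius norm "is a matrix norm because `‖AB‖₂ ≤ … = ‖A‖₂‖B‖₂`")] -/
theorem sqrt_frobSq_mul_le {k l r : ℕ} (X : Matrix (Fin k) (Fin l) ℝ) (Y : Matrix (Fin l) (Fin r) ℝ) :
    Real.sqrt (frobSq (X * Y)) ≤ Real.sqrt (frobSq X) * Real.sqrt (frobSq Y) := by
  simp only [sqrt_frobSq_eq_norm]; exact Matrix.frobenius_norm_mul X Y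

end frobenius

/-- `‖Xᵀ‖_F = ‖X‖_F`. [folklore] -/
private theorem sqrt_frobSq_transpose {k l : ℕ} (X : Matrix (Fin k) (Fin l) ℝ) :
    Real.sqrt (frobSq Xᵀ) = Real.sqrt (frobSq X) := by rw [frobSq_transpose]

/-- **`‖Rᵀ Y R‖_F ≤ ‖R‖_F² ‖Y‖_F`** — the Frobenius relaxation of the printed step
`‖R†(·)R‖ ≤ ‖R‖²‖·‖` (`‖R‖ ≤ ‖R‖_F`). [cite: ChiaEtAl2022, §5.3 proof of Theorem "evenSing",
last display, third line] -/
theorem sqrt_frobSq_transpose_mul_mul_le (R : Matrix (Fin s) (Fin n) ℝ) (Y : Matrix (Fin s) (Fin s) ℝ) :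
    Real.sqrt (frobSq (Rᵀ * Y * R)) ≤ frobSq R * Real.sqrt (frobSq Y) := by
  calc Real.sqrt (frobSq (Rᵀ * Y * R))
      ≤ Real.sqrt (frobSq (Rᵀ * Y)) * Real.sqrt (frobSq R) := sqrt_frobSq_mul_le _ _
    _ ≤ Real.sqrt (frobSq Rᵀ) * Real.sqrt (frobSq Y) * Real.sqrt (frobSq R) :=
        mul_le_mul_of_nonneg_right (sqrt_frobSq_mul_le _ _) (Real.sqrt_nonneg _)
    _ = frobSq R * Real.sqrt (frobSq Y) := by
        rw [sqrt_frobSq_transpose, mul_right_comm, Real.mul_self_sqrt (frobSq_nonneg R)]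

/-! ### The push-through step `Rᵀ \bar f(RRᵀ) R = f(RᵀR)` -/

/-- The spectrum of a real Gram matrix `RᵀR` lies in `[0, ∞)`. [folklore] -/
private theorem spectrum_transpose_mul_self_nonneg (R : Matrix (Fin s) (Fin n) ℝ) {x : ℝ}
    (hx : x ∈ spectrum ℝ (Rᵀ * R)) : 0 ≤ x := by
  have hP : (Rᵀ * R).PosSemidef := by
    simpa [Matrix.conjTranspose_eq_transpose_of_trivial] using Matrix.posSemidef_conjTranspose_mul_self R
  rw [hP.1.spectrum_real_eq_range_eigenvalues] at hx
  obtain ⟨i, rfl⟩ := hx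
  exact hP.eigenvalues_nonneg i

/-- **"= (definition of `\bar f`)"**: if `x \bar f(x) = f(x)` for all `x ≥ 0` (e.g. `f(0) = 0` and
`\bar f(x) = f(x)/x`), then `Rᵀ \bar f(RRᵀ) R = f(RᵀR)` — Higham's push-through identity
`Rᵀ \bar f(RRᵀ) R = (x \bar f(x))(RᵀR)` and `spec(RᵀR) ⊆ [0,∞)`.
[cite: ChiaEtAl2022, §5.3 proof of Theorem "evenSing", last display, second line];
[cite: Higham2008, §1.8 Cor. 1.34] -/
theorem transpose_mul_cfc_mul_self_eq (R : Matrix (Fin s) (Fin n) ℝ) (f fbar : ℝ → ℝ)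
    (hff : ∀ x : ℝ, 0 ≤ x → x * fbar x = f x) :
    Rᵀ * cfc fbar (R * Rᵀ) * R = cfc f (Rᵀ * R) := by
  have h := PushThrough.conjTranspose_mul_cfc_mul_self (𝕜 := ℝ) R fbar
  simp only [Matrix.conjTranspose_eq_transpose_of_trivial] at h
  rw [h]
  exact cfc_congr fun x hx => hff x (spectrum_transpose_mul_self_nonneg R hx)

/-! ### The error decomposition (deterministic) -/

/-- `‖−X‖_F² = ‖X‖_F²`. [folklore] -/
private theorem frobSq_neg {k l : ℕ} (X : Matrix (Fin k) (Fin l) ℝ) : frobSq (-X) = frobSq X := by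
  simp [frobSq_eq_sum_sq]

/-- **Even-SVT error decomposition** (the printed chain, Frobenius form): for any real `R`
(`s×n`), `C` (`s×c`), `A` (`m×n`) and `f, \bar f` with `x \bar f(x) = f(x)` on `[0,∞)`,
`‖Rᵀ \bar f(CCᵀ) R − f(AᵀA)‖_F ≤ ‖f(RᵀR) − f(AᵀA)‖_F + ‖R‖_F² · ‖\bar f(RRᵀ) − \bar f(CCᵀ)‖_F`.
[cite: ChiaEtAl2022, §5.3 proof of Theorem "evenSing", last display ("Using the above points, we
can conclude")] -/
theorem evenSVT_error_le (R : Matrix (Fin s) (Fin n) ℝ) (C : Matrix (Fin s) (Fin c) ℝ)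
    (A : Matrix (Fin m) (Fin n) ℝ) (f fbar : ℝ → ℝ) (hff : ∀ x : ℝ, 0 ≤ x → x * fbar x = f x) :
    Real.sqrt (frobSq (Rᵀ * cfc fbar (C * Cᵀ) * R - cfc f (Aᵀ * A))) ≤
      Real.sqrt (frobSq (cfc f (Rᵀ * R) - cfc f (Aᵀ * A))) +
        frobSq R * Real.sqrt (frobSq (cfc fbar (R * Rᵀ) - cfc fbar (C * Cᵀ))) := by
  have hsplit : Rᵀ * cfc fbar (C * Cᵀ) * R - cfc f (Aᵀ * A) =
      (Rᵀ * cfc fbar (R * Rᵀ) * R - cfc f (Aᵀ * A)) +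
        Rᵀ * (cfc fbar (C * Cᵀ) - cfc fbar (R * Rᵀ)) * R := by
    rw [Matrix.mul_sub, Matrix.sub_mul]; abel
  rw [hsplit, transpose_mul_cfc_mul_self_eq R f fbar hff]
  refine (sqrt_frobSq_add_le _ _).trans (add_le_add le_rfl ?_)
  calc Real.sqrt (frobSq (Rᵀ * (cfc fbar (C * Cᵀ) - cfc fbar (R * Rᵀ)) * R))
      ≤ frobSq R * Real.sqrt (frobSq (cfc fbar (C * Cᵀ) - cfc fbar (R * Rᵀ))) :=
        sqrt_frobSq_transpose_mul_mul_le R _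
    _ = frobSq R * Real.sqrt (frobSq (cfc fbar (R * Rᵀ) - cfc fbar (C * Cᵀ))) := by
        rw [← neg_sub, frobSq_neg]

/-! ### The theorem: even singular value transformation by two-stage sketching -/

/-- Inclusion–exclusion step: the mass of `E ∩ G` is at least the mass of `E` minus the mass of
`Gᶜ` (non-negative weights). `[folklore]` (private plumbing) -/
private theorem sum_filter_and_ge' {ι : Type*} (u : Finset ι) (w : ι → ℝ) (hw : ∀ i, 0 ≤ w i)
    (E G : ι → Prop) [DecidablePred E] [DecidablePred G] :
    ∑ i ∈ u.filter E, w i - ∑ i ∈ u.filter (fun i => ¬ G i), w i ≤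
      ∑ i ∈ u.filter (fun i => E i ∧ G i), w i := by
  classical
  have hsplit : ∑ i ∈ u.filter E, w i =
      ∑ i ∈ (u.filter E).filter G, w i + ∑ i ∈ (u.filter E).filter (fun i => ¬ G i), w i :=
    (sum_filter_add_sum_filter_not _ _ _).symm
  rw [hsplit, filter_filter]
  have hle : ∑ i ∈ (u.filter E).filter (fun i => ¬ G i), w i ≤ ∑ i ∈ u.filter (fun i => ¬ G i), w i :=
    sum_le_sum_of_subset_of_nonneg (fun i hi => by
      simp only [mem_filter] at hi ⊢; exact ⟨hi.1.1, hi.2⟩) (fun i _ _ => hw i)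
  linarith

/-- **Theorem (even singular value transformation; CGLLTW §5.3, Frobenius form, explicit
constants).**  Let `SQ_φ(A)` be given (`A ≠ 0`, witness `Ã`), `s, c ≥ 1`, `δ₁, δ₂, δ₃ > 0`,
`s ≥ 2φ² ln(1/δ₃)`; let `f, \bar f : ℝ → ℝ` satisfy `|f x − f y| ≤ L|x − y|`,
`|\bar f x − \bar f y| ≤ \bar L|x − y|` for `x, y ≥ 0` (`L, \bar L ≥ 0`) and `x \bar f(x) = f(x)`
for `x ≥ 0` (i.e. `f(0) = 0`, `\bar f = f(x)/x` off `0`).  Sample `ω ∈ [m]^s` i.i.d. from `𝒟_ã`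
(row sketch `S_ω`, `R = S_ωA`) and then `τ ∈ [n]^c` i.i.d. from the row-norm distribution of
`(S_ωÃ)ᵀ` (Lemma 2.14's `SQ((SA)†)` sampler; column sketch `T_τ`, `C = RT_τᵀ`, so
`CCᵀ = (T_τRᵀ)ᵀ(T_τRᵀ)`).  Then the two-stage mass of the outcomes `(ω, τ)` with
`‖Rᵀ \bar f(CCᵀ) R − f(AᵀA)‖_F ≤ (L√(8φ² log(2/δ₁)/s) + \bar L φ² √(32φ² log(2/δ₂)/c) ‖A‖_F²)·‖A‖_F²`
exceeds `1 − δ₁ − δ₂ − δ₃`.  Ingredients, as printed: the key lemma for `S` and Lemma 5.4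
(`‖f(RᵀR) − f(AᵀA)‖_F ≤ L‖RᵀR − AᵀA‖_F < L√(8φ² log(2/δ₁)/s)‖A‖_F²`, mass `> 1 − δ₁`); Lemma 2.14
(`φ_ω ≤ 2φ` off an event of mass `≤ δ₃`) with the key lemma for `T†` and Lemma 5.4
(`‖\bar f(RRᵀ) − \bar f(CCᵀ)‖_F ≤ \bar L‖CCᵀ − RRᵀ‖_F < \bar L√(8(2φ)² log(2/δ₂)/c)‖R‖_F²`, mass
`> 1 − δ₂` for every good `ω`); `‖R‖_F² ≤ φ‖A‖_F²`; and the decomposition `evenSVT_error_le`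
(whose `‖R‖_F²` is the Frobenius relaxation of the printed `‖R‖²`).
[cite: ChiaEtAl2022, §5.3 Theorem "evenSing" and its proof (p. 37: the four bullets and "Using
the above points, we can conclude")] -/
theorem even_singular_value_transformation (W : MatrixOversamplingWitness φ A) (hA : A ≠ 0)
    (hs : 0 < s) (hc : 0 < c) {δ₁ δ₂ δ₃ : ℝ} (hδ₁ : 0 < δ₁) (hδ₂ : 0 < δ₂) (hδ₃ : 0 < δ₃)
    (hsδ : 2 * φ ^ 2 * Real.log (1 / δ₃) ≤ s) (f fbar : ℝ → ℝ) {L Lbar : ℝ} (hL0 : 0 ≤ L)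
    (hL : ∀ x y : ℝ, 0 ≤ x → 0 ≤ y → |f x - f y| ≤ L * |x - y|) (hLb0 : 0 ≤ Lbar)
    (hLb : ∀ x y : ℝ, 0 ≤ x → 0 ≤ y → |fbar x - fbar y| ≤ Lbar * |x - y|)
    (hff : ∀ x : ℝ, 0 ≤ x → x * fbar x = f x) :
    1 - δ₁ - δ₂ - δ₃ <
      ∑ ω : Fin s → Fin m, iidWeight (rowDist W.tilde) ω *
        ∑ τ ∈ univ.filter (fun τ : Fin c → Fin n =>
          Real.sqrt (frobSq ((sketch (rowDist W.tilde) ω * A)ᵀ *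
              cfc fbar ((sketch (rowDist (sketch (rowDist W.tilde) ω * W.tilde)ᵀ) τ *
                  (sketch (rowDist W.tilde) ω * A)ᵀ)ᵀ *
                (sketch (rowDist (sketch (rowDist W.tilde) ω * W.tilde)ᵀ) τ *
                  (sketch (rowDist W.tilde) ω * A)ᵀ)) *
              (sketch (rowDist W.tilde) ω * A) - cfc f (Aᵀ * A))) ≤
            (L * Real.sqrt (8 * φ ^ 2 * Real.log (2 / δ₁) / s) +
              Lbar * φ ^ 2 * Real.sqrt (32 * φ ^ 2 * Real.log (2 / δ₂) / c) * frobSq A) * frobSq A),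
          iidWeight (rowDist (sketch (rowDist W.tilde) ω * W.tilde)ᵀ) τ := by
  classical
  -- notation
  set p : Fin m → ℝ := rowDist W.tilde with hpdef
  set θ₁ : ℝ := Real.sqrt (8 * φ ^ 2 * Real.log (2 / δ₁) / s) * frobSq A with hθ₁
  set θ₂ : ℝ := φ * Real.sqrt (32 * φ ^ 2 * Real.log (2 / δ₂) / c) * frobSq A with hθ₂
  set Θ : ℝ := (L * Real.sqrt (8 * φ ^ 2 * Real.log (2 / δ₁) / s) +
      Lbar * φ ^ 2 * Real.sqrt (32 * φ ^ 2 * Real.log (2 / δ₂) / c) * frobSq A) * frobSq A with hΘ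
  have hΘ' : Θ = L * θ₁ + φ * frobSq A * (Lbar * θ₂) := by rw [hΘ, hθ₁, hθ₂]; ring
  have hp := W.isOversampledDist_rowDist hA
  have hφ := W.pos hA
  have hF : 0 < frobSq A := frobSq_pos hA
  have hw0 : ∀ ω : Fin s → Fin m, 0 ≤ iidWeight p ω := iidWeight_nonneg hp.nonneg
  have hθ₂0 : 0 ≤ θ₂ := by rw [hθ₂]; exact mul_nonneg (mul_nonneg hφ.le (Real.sqrt_nonneg _)) hF.le
  -- stage 1 events: `E₁` = key lemma for `S`, `G` = Lemma 2.14's good event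
  let E₁ : (Fin s → Fin m) → Prop := fun ω =>
    Real.sqrt (frobSq ((sketch p ω * A)ᵀ * (sketch p ω * A) - Aᵀ * A)) < θ₁
  let G : (Fin s → Fin m) → Prop := fun ω => frobSq A / 2 ≤ frobSq (sketch p ω * A)
  have hE₁ : 1 - δ₁ < ∑ ω ∈ univ.filter E₁, iidWeight p ω := by
    have hkey := approx_matrix_product' hp hp hφ hφ hA hA hs hδ₁
    have havg : (fun k => (p k + p k) / 2) = p := funext fun k => by ring
    rw [havg] at hkey
    have hthr' : Real.sqrt (8 * φ * φ * Real.log (2 / δ₁) / s) *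
        (Real.sqrt (frobSq A) * Real.sqrt (frobSq A)) = θ₁ := by
      rw [hθ₁, Real.mul_self_sqrt (frobSq_nonneg A), show (8 : ℝ) * φ * φ = 8 * φ ^ 2 by ring]
    rw [hthr'] at hkey
    exact hkey
  have hG : ∑ ω ∈ univ.filter (fun ω => ¬ G ω), iidWeight p ω ≤ δ₃ := by
    have h := iid_mass_frobSq_sketch_lt_half_le W hA hs hδ₃ hsδ
    refine le_of_eq_of_le (sum_congr ?_ fun _ _ => rfl) h
    ext ω; simp only [mem_filter, mem_univ, true_and, G, not_le, hpdef]
  have hEG : 1 - δ₁ - δ₃ < ∑ ω ∈ univ.filter (fun ω => E₁ ω ∧ G ω), iidWeight p ω := by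
    have := sum_filter_and_ge' univ (iidWeight p) hw0 E₁ G
    linarith
  -- the good event for `(ω, τ)`
  let good : (Fin s → Fin m) → (Fin c → Fin n) → Prop := fun ω τ =>
    Real.sqrt (frobSq ((sketch p ω * A)ᵀ *
        cfc fbar ((sketch (rowDist (sketch p ω * W.tilde)ᵀ) τ * (sketch p ω * A)ᵀ)ᵀ *
          (sketch (rowDist (sketch p ω * W.tilde)ᵀ) τ * (sketch p ω * A)ᵀ)) *
        (sketch p ω * A) - cfc f (Aᵀ * A))) ≤ Θ
  -- stage 2: for every good `ω`, the `τ`-mass of the good outcomes exceeds `1 − δ₂`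
  have hstage2 : ∀ ω, E₁ ω ∧ G ω →
      1 - δ₂ < ∑ τ ∈ univ.filter (fun τ : Fin c → Fin n => good ω τ),
        iidWeight (rowDist (sketch p ω * W.tilde)ᵀ) τ := by
    rintro ω ⟨hωE, hωG⟩
    set R := sketch p ω * A with hRdef
    have hRpos : 0 < frobSq R := lt_of_lt_of_le (by linarith) hωG
    have hRne : R ≠ 0 := fun h0 => by
      rw [h0] at hRpos; simp [frobSq_eq_sum_sq] at hRpos
    have hRtne : Rᵀ ≠ 0 := fun h0 => hRne (by simpa using congrArg Matrix.transpose h0)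
    -- the witness `SQ_{φ_ω}((S_ωA)ᵀ)` of Lemma 2.14, with `φ_ω ≤ 2φ`
    let W₂ := (W.sketched ω hRne).transpose
    have hφω : sketchPhi W ω ≤ 2 * φ := sketchPhi_le_two_mul W hA ω hωG
    have hq : IsOversampledDist (2 * φ) (rowNorms Rᵀ) (rowDist (sketch p ω * W.tilde)ᵀ) := by
      have h := W₂.isOversampledDist_rowDist hRtne
      simp only [W₂, MatrixOversamplingWitness.transpose_tilde,
        MatrixOversamplingWitness.sketched_tilde] at h
      exact h.mono (W₂.pos hRtne) hφω
    have h2φ : 0 < 2 * φ := by linarith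
    have hkey := approx_matrix_product' hq hq h2φ h2φ hRtne hRtne hc hδ₂
    have havg : (fun k => (rowDist (sketch p ω * W.tilde)ᵀ k + rowDist (sketch p ω * W.tilde)ᵀ k) / 2) =
        rowDist (sketch p ω * W.tilde)ᵀ := funext fun k => by ring
    rw [havg] at hkey
    -- the stage-2 threshold is at most `θ₂` since `‖Rᵀ‖_F² = ‖SA‖_F² ≤ φ‖A‖_F²`
    have hRle : frobSq R ≤ φ * frobSq A := frobSq_sketch_mul_le hp hφ ω
    have hRtle : frobSq Rᵀ ≤ φ * frobSq A := by rw [frobSq_transpose]; exact hRle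
    have hthr2 : Real.sqrt (8 * (2 * φ) * (2 * φ) * Real.log (2 / δ₂) / c) *
        (Real.sqrt (frobSq Rᵀ) * Real.sqrt (frobSq Rᵀ)) ≤ θ₂ := by
      rw [Real.mul_self_sqrt (frobSq_nonneg _), hθ₂,
        show (8 : ℝ) * (2 * φ) * (2 * φ) = 32 * φ ^ 2 by ring]
      calc Real.sqrt (32 * φ ^ 2 * Real.log (2 / δ₂) / c) * frobSq Rᵀ
          ≤ Real.sqrt (32 * φ ^ 2 * Real.log (2 / δ₂) / c) * (φ * frobSq A) :=
            mul_le_mul_of_nonneg_left hRtle (Real.sqrt_nonneg _)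
        _ = φ * Real.sqrt (32 * φ ^ 2 * Real.log (2 / δ₂) / c) * frobSq A := by ring
    refine lt_of_lt_of_le hkey (sum_le_sum_of_subset_of_nonneg ?_ fun τ _ _ =>
      iidWeight_nonneg hq.nonneg τ)
    intro τ hτ
    simp only [mem_filter, mem_univ, true_and] at hτ ⊢
    set T := sketch (rowDist (sketch p ω * W.tilde)ᵀ) τ with hTdef
    -- the two Lemma-5.4 steps
    have h54₁ : Real.sqrt (frobSq (cfc f (Rᵀ * R) - cfc f (Aᵀ * A))) ≤ L * θ₁ :=
      (frobNorm_cfc_gram_sub_le R A f hL0 hL).trans (mul_le_mul_of_nonneg_left hωE.le hL0)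
    have h54₂ : Real.sqrt (frobSq (cfc fbar (R * Rᵀ) - cfc fbar ((T * Rᵀ)ᵀ * (T * Rᵀ)))) ≤
        Lbar * θ₂ := by
      have h := frobNorm_cfc_gram_sub_le Rᵀ (T * Rᵀ) fbar hLb0 hLb
      simp only [Matrix.transpose_transpose] at h
      have hev : Real.sqrt (frobSq (R * Rᵀ - (T * Rᵀ)ᵀ * (T * Rᵀ))) ≤ θ₂ := by
        rw [← frobSq_neg, neg_sub]
        have hτ' := hτ
        simp only [Matrix.transpose_transpose] at hτ'
        exact (hτ'.le).trans hthr2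
      exact h.trans (mul_le_mul_of_nonneg_left hev hLb0)
    -- the decomposition
    show Real.sqrt (frobSq (Rᵀ * cfc fbar ((T * Rᵀ)ᵀ * (T * Rᵀ)) * R - cfc f (Aᵀ * A))) ≤ Θ
    have hdec := evenSVT_error_le R (T * Rᵀ)ᵀ A f fbar hff
    simp only [Matrix.transpose_transpose] at hdec
    calc _ ≤ _ := hdec
      _ ≤ L * θ₁ + frobSq R * (Lbar * θ₂) := add_le_add h54₁
          (mul_le_mul_of_nonneg_left h54₂ (frobSq_nonneg R))
      _ ≤ L * θ₁ + φ * frobSq A * (Lbar * θ₂) := by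
          have : 0 ≤ Lbar * θ₂ := mul_nonneg hLb0 hθ₂0
          nlinarith
      _ = Θ := hΘ'.symm
  -- assemble: total mass ≥ Σ_{ω ∈ E₁ ∩ G} w(ω) (1 − δ₂) ≥ (1 − δ₁ − δ₃)(1 − δ₂) ≥ 1 − δ₁ − δ₂ − δ₃
  have hinner_nonneg : ∀ ω : Fin s → Fin m, 0 ≤ ∑ τ ∈ univ.filter (fun τ : Fin c → Fin n =>
      good ω τ), iidWeight (rowDist (sketch p ω * W.tilde)ᵀ) τ := fun ω =>
    sum_nonneg fun τ _ => iidWeight_nonneg (fun k => div_nonneg (normSq_nonneg _) (frobSq_nonneg _)) τ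
  show 1 - δ₁ - δ₂ - δ₃ < ∑ ω : Fin s → Fin m, iidWeight p ω *
      ∑ τ ∈ univ.filter (fun τ : Fin c → Fin n => good ω τ),
        iidWeight (rowDist (sketch p ω * W.tilde)ᵀ) τ
  rcases le_or_gt 1 δ₂ with hδ₂1 | hδ₂1
  · calc 1 - δ₁ - δ₂ - δ₃ < 0 := by linarith
      _ ≤ _ := sum_nonneg fun ω _ => mul_nonneg (hw0 ω) (hinner_nonneg ω)
  calc 1 - δ₁ - δ₂ - δ₃ ≤ (1 - δ₁ - δ₃) * (1 - δ₂) := by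
        have : 0 ≤ δ₂ * (δ₁ + δ₃) := by positivity
        nlinarith
    _ < (∑ ω ∈ univ.filter (fun ω => E₁ ω ∧ G ω), iidWeight p ω) * (1 - δ₂) :=
        mul_lt_mul_of_pos_right hEG (by linarith)
    _ = ∑ ω ∈ univ.filter (fun ω => E₁ ω ∧ G ω), iidWeight p ω * (1 - δ₂) := by rw [sum_mul]
    _ ≤ ∑ ω ∈ univ.filter (fun ω => E₁ ω ∧ G ω), iidWeight p ω *
          ∑ τ ∈ univ.filter (fun τ : Fin c → Fin n => good ω τ),
            iidWeight (rowDist (sketch p ω * W.tilde)ᵀ) τ :=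
        sum_le_sum fun ω hω => mul_le_mul_of_nonneg_left
          (hstage2 ω (by simpa only [mem_filter, mem_univ, true_and] using hω)).le (hw0 ω)
    _ ≤ _ := sum_le_sum_of_subset_of_nonneg (filter_subset _ _) fun ω _ _ =>
          mul_nonneg (hw0 ω) (hinner_nonneg ω)

/-! ### Sample complexity: the `r, c = Ω(…)` form -/

/-- Square-root thresholds: if `ℓ > 0`, `K > 0` and `u ≥ a·K²·ℓ/ε²·4` (written as the hypothesis
`4 * a * K ^ 2 * ℓ / ε ^ 2 ≤ u`), then `K·√(a ℓ / u) ≤ ε/2`. `[folklore]` (private plumbing) -/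
private theorem mul_sqrt_div_le_half {a K ℓ u ε : ℝ} (ha : 0 ≤ a) (hK : 0 < K) (hℓ : 0 < ℓ)
    (hε : 0 < ε) (hu : 4 * a * K ^ 2 * ℓ / ε ^ 2 ≤ u) : K * Real.sqrt (a * ℓ / u) ≤ ε / 2 := by
  rcases eq_or_lt_of_le ha with rfl | ha'
  · simp [le_of_lt (half_pos hε)]
  have hu0 : 0 < u := lt_of_lt_of_le (by positivity) hu
  have hq : a * ℓ / u ≤ (ε / (2 * K)) ^ 2 := by
    rw [div_le_iff₀ hu0]
    calc a * ℓ = (ε / (2 * K)) ^ 2 * (4 * a * K ^ 2 * ℓ / ε ^ 2) := by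
          field_simp
          ring
      _ ≤ (ε / (2 * K)) ^ 2 * u := mul_le_mul_of_nonneg_left hu (sq_nonneg _)
  calc K * Real.sqrt (a * ℓ / u) ≤ K * (ε / (2 * K)) :=
        mul_le_mul_of_nonneg_left ((Real.sqrt_le_sqrt hq).trans_eq
          (Real.sqrt_sq (by positivity))) hK.le
    _ = ε / 2 := by field_simp

/-- **Even singular value transformation, sample-complexity form** (the printed `r, c = Ω̃(…)`,
Frobenius case "no additional log terms"): with `δ ∈ (0,1]`, `ε > 0` and
`s ≥ 32 φ² L² ‖A‖_F⁴ log(6/δ)/ε²`, `s ≥ 2φ² ln(3/δ)`, `c ≥ 128 φ⁶ \bar L² ‖A‖_F⁸ log(6/δ)/ε²`, the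
two-stage mass of `‖Rᵀ \bar f(CCᵀ) R − f(AᵀA)‖_F ≤ ε` exceeds `1 − δ` (`δ₁ = δ₂ = δ₃ = δ/3` in
`even_singular_value_transformation`).  Compared with the print,
`r = Ω̃(φ² L² ‖A‖_*² ‖A‖_F² ε⁻² log(1/δ))`, `c = Ω̃(φ² \bar L² ‖A‖⁴ ‖A‖_*² ‖A‖_F² ε⁻² log(1/δ))`,
`* = F`, the operator norm `‖A‖⁴` is replaced by `φ²‖A‖_F⁴` (the Frobenius relaxation
`‖R‖² ≤ ‖R‖_F² ≤ φ‖A‖_F²` of `evenSVT_error_le`) and `δ` enters additively (`log(6/δ)`, union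
bound) rather than through a median-boosted `log(1/δ)`.
[cite: ChiaEtAl2022, §3.1 Theorem "Even singular value transformation", displayed `r, c` and
"no additional log terms are necessary (i.e., `Ω̃` becomes `Ω`) when Frobenius norm is used"] -/
theorem even_singular_value_transformation_sample_complexity (W : MatrixOversamplingWitness φ A)
    (hA : A ≠ 0) (hs : 0 < s) (hc : 0 < c) {δ ε : ℝ} (hδ : 0 < δ) (hδ1 : δ ≤ 1) (hε : 0 < ε)
    (f fbar : ℝ → ℝ) {L Lbar : ℝ} (hL0 : 0 ≤ L)
    (hL : ∀ x y : ℝ, 0 ≤ x → 0 ≤ y → |f x - f y| ≤ L * |x - y|) (hLb0 : 0 ≤ Lbar)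
    (hLb : ∀ x y : ℝ, 0 ≤ x → 0 ≤ y → |fbar x - fbar y| ≤ Lbar * |x - y|)
    (hff : ∀ x : ℝ, 0 ≤ x → x * fbar x = f x)
    (hsL : 32 * φ ^ 2 * L ^ 2 * frobSq A ^ 2 * Real.log (6 / δ) / ε ^ 2 ≤ s)
    (hs3 : 2 * φ ^ 2 * Real.log (3 / δ) ≤ s)
    (hcL : 128 * φ ^ 6 * Lbar ^ 2 * frobSq A ^ 4 * Real.log (6 / δ) / ε ^ 2 ≤ c) :
    1 - δ <
      ∑ ω : Fin s → Fin m, iidWeight (rowDist W.tilde) ω *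
        ∑ τ ∈ univ.filter (fun τ : Fin c → Fin n =>
          Real.sqrt (frobSq ((sketch (rowDist W.tilde) ω * A)ᵀ *
              cfc fbar ((sketch (rowDist (sketch (rowDist W.tilde) ω * W.tilde)ᵀ) τ *
                  (sketch (rowDist W.tilde) ω * A)ᵀ)ᵀ *
                (sketch (rowDist (sketch (rowDist W.tilde) ω * W.tilde)ᵀ) τ *
                  (sketch (rowDist W.tilde) ω * A)ᵀ)) *
              (sketch (rowDist W.tilde) ω * A) - cfc f (Aᵀ * A))) ≤ ε),
          iidWeight (rowDist (sketch (rowDist W.tilde) ω * W.tilde)ᵀ) τ := by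
  classical
  have hδ3 : 0 < δ / 3 := by positivity
  have hmain := even_singular_value_transformation W hA hs hc hδ3 hδ3 hδ3
    (by rwa [show (1 : ℝ) / (δ / 3) = 3 / δ by rw [div_div_eq_mul_div, one_mul]]) f fbar hL0 hL hLb0 hLb hff
  have h13 : 1 - δ / 3 - δ / 3 - δ / 3 = 1 - δ := by ring
  rw [h13, show (2 : ℝ) / (δ / 3) = 6 / δ by rw [div_div_eq_mul_div]; norm_num] at hmain
  -- the threshold of the main theorem is at most `ε`
  have hφ := W.pos hA
  have hF : 0 < frobSq A := frobSq_pos hA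
  have hℓ : 0 < Real.log (6 / δ) := Real.log_pos (by rw [lt_div_iff₀ hδ]; linarith)
  have h1 : L * Real.sqrt (8 * φ ^ 2 * Real.log (6 / δ) / s) * frobSq A ≤ ε / 2 := by
    rcases eq_or_lt_of_le hL0 with rfl | hLpos
    · simp [le_of_lt (half_pos hε)]
    have hK : 0 < L * frobSq A := mul_pos hLpos hF
    have := mul_sqrt_div_le_half (a := 8 * φ ^ 2) (K := L * frobSq A) (ℓ := Real.log (6 / δ))
      (u := (s : ℝ)) (by positivity) hK hℓ hε (by
        calc 4 * (8 * φ ^ 2) * (L * frobSq A) ^ 2 * Real.log (6 / δ) / ε ^ 2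
            = 32 * φ ^ 2 * L ^ 2 * frobSq A ^ 2 * Real.log (6 / δ) / ε ^ 2 := by ring
          _ ≤ (s : ℝ) := hsL)
    calc L * Real.sqrt (8 * φ ^ 2 * Real.log (6 / δ) / s) * frobSq A
        = L * frobSq A * Real.sqrt (8 * φ ^ 2 * Real.log (6 / δ) / s) := by ring
      _ ≤ ε / 2 := this
  have h2 : Lbar * φ ^ 2 * Real.sqrt (32 * φ ^ 2 * Real.log (6 / δ) / c) * frobSq A * frobSq A ≤
      ε / 2 := by
    rcases eq_or_lt_of_le hLb0 with rfl | hLbpos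
    · simp [le_of_lt (half_pos hε)]
    have hK : 0 < Lbar * φ ^ 2 * frobSq A ^ 2 := by positivity
    have := mul_sqrt_div_le_half (a := 32 * φ ^ 2) (K := Lbar * φ ^ 2 * frobSq A ^ 2)
      (ℓ := Real.log (6 / δ)) (u := (c : ℝ)) (by positivity) hK hℓ hε (by
        calc 4 * (32 * φ ^ 2) * (Lbar * φ ^ 2 * frobSq A ^ 2) ^ 2 * Real.log (6 / δ) / ε ^ 2
            = 128 * φ ^ 6 * Lbar ^ 2 * frobSq A ^ 4 * Real.log (6 / δ) / ε ^ 2 := by ring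
          _ ≤ (c : ℝ) := hcL)
    calc Lbar * φ ^ 2 * Real.sqrt (32 * φ ^ 2 * Real.log (6 / δ) / c) * frobSq A * frobSq A
        = Lbar * φ ^ 2 * frobSq A ^ 2 * Real.sqrt (32 * φ ^ 2 * Real.log (6 / δ) / c) := by ring
      _ ≤ ε / 2 := this
  have hΘε : (L * Real.sqrt (8 * φ ^ 2 * Real.log (6 / δ) / s) +
      Lbar * φ ^ 2 * Real.sqrt (32 * φ ^ 2 * Real.log (6 / δ) / c) * frobSq A) * frobSq A ≤ ε := by
    have := add_le_add h1 h2
    calc _ = L * Real.sqrt (8 * φ ^ 2 * Real.log (6 / δ) / s) * frobSq A +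
          Lbar * φ ^ 2 * Real.sqrt (32 * φ ^ 2 * Real.log (6 / δ) / c) * frobSq A * frobSq A := by
            ring
      _ ≤ ε / 2 + ε / 2 := this
      _ = ε := by ring
  -- monotonicity of the event
  refine lt_of_lt_of_le hmain (sum_le_sum fun ω _ => mul_le_mul_of_nonneg_left
    (sum_le_sum_of_subset_of_nonneg ?_ fun τ _ _ =>
      iidWeight_nonneg (fun k => div_nonneg (normSq_nonneg _) (frobSq_nonneg _)) τ)
    (iidWeight_nonneg (W.isOversampledDist_rowDist hA).nonneg ω))
  intro τ hτ
  simp only [mem_filter, mem_univ, true_and] at hτ ⊢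
  exact hτ.trans hΘε

end SampleQuery

end Literature.Computability.QuantumComplexity
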